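import Literature.Probability.RandomPlanarGeometry.HexSAWStripBridgeLengthResidue
import HarnessLib

/-!
# ★★★★ The POINTWISE law of the critical strip bridges counted by LENGTH: `D(2k + χ_a − χ_b)_{ab} → 2ρ′ u′_a ℓ′_b`
# (module «LENGTH-POINTWISE-LAW»; period two handled by the parity-shifted renewal pair)

Topic `Literature/Probability/RandomPlanarGeometry` (continues «LENGTH-NEUMANN» `HexSAWStripBridgeLengthResidue.lean` — the x-residue
`HV.exists_tendsto_stripLenD_residue` `(1 − s) D_T(s)_{ab} → ρ′u′_aℓ′_b`, the finite mean length `HV.summable_length_mul_LMM`, the slices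
`HV.lenSlices_basic` —, «BRIDGE-LENGTH-RENEWAL» `HexSAWStripBridgeLengthRenewal.lean` (`HV.LUM_eq_split`, `HV.LUM_ren`, truncation
independence), «LENGTH-POINTWISE» (`HV.exists_LUs_stripYT_le`), `HexSAWStripBridgeRenewal.lean` §5 (`HV.pair_mem_HBk`: one-step slants),
`HexSAWStrip.lean` (`HV.lev_eq_of_adj`: a lattice step moves the level by `±1`), and the tree's MATRIX RENEWAL THEOREM
`Literature/Probability/Process/MatrixRenewalCoefficients.lean` (`RenewalKernelPair`, `RenewalKernelPair.Critical`,
`RenewalKernelPair.tendsto_coeff`: Erdős–Feller–Pollard through the taboo decomposition)).  Lane «pcv-sawmu» (CriticalPhenomena venture),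
a-p2 g21 — item (L5) of HANDOFF a-p2 g19/g21: the last step of the LENGTH programme.  Sources of the SETTING: W. Feller, vol. I (1968)
XIII.3 (periodic recurrent events: reduction to the aperiodic case), XIII.11; E. Seneta (1973) Chapter 6; H. Duminil-Copin, A. Hammond,
CMP 324 (2013) §2.2; H. Kesten, J. Math. Phys. 4 (1963) §4 (irreducible bridges).  Nothing of the kind is printed for the strip.

## The obstacle and the device
Lengths of bridges `a → b` have the parity of `b − a` (§B), so `D(n)_{aa} > 0` only for even `n`: the length kernel has PERIOD TWO and
the aperiodic matrix renewal theorem does not apply to `(M(n), D(n))` directly.  With `χ_a ∈ {0,1}` the level parity, the HAT PAIR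
`M̂(k)_{ab} := M(2k + χ_a − χ_b)_{ab}`, `D̂(k)_{ab} := D(2k + χ_a − χ_b)_{ab}` (the similarity `diag(1, s)` on the generating functions,
written in coefficients) satisfies the SAME renewal equation `D̂ = M̂ + M̂ ∗ D̂` exactly (`χ_a − χ_c` and `χ_c − χ_b` add up), is
aperiodic (`D̂(k)_{aa} = D(2k)_{aa} > 0` for all `k ≥ 1`), and inherits summability, the Abelian limit (doubled: `s = t²`,
`(1 − t²) t^e D_T(t) → 2L`) and the finite first moment — i.e. it is `Critical`, and `tendsto_coeff` applies.

## What is proved (namespace `Literature.Probability.RandomPlanarGeometry.SAW.HV`; `y_T = stripYT T`, `D(n) = LUM T n n y_T`, `M(n) = LMM T n n y_T`)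

* §A `LMM_mul_LUM_le_LUM`, ★ `pow_LMM_one_le_LUM` (`D(m) ≥ M(1)^m`), `pow_sq_apply_le_pow_two_mul`, `wD_pos`, `LMM_one_pos_of_mem`,
  ★ `LMM_one_pair_pos` (`M(1)` links the paired levels `2j ↔ 2j+1`), ★★ `LUM_even_diag_pos` — `D(2k)_{aa} > 0` (`y > 0`, `k ≥ 1`).
* §B `chain_parity_even`, ★ `LUM_LMM_eq_zero_of_not_even` (parity of the slices); `lchi`, `hatLen`, `hatM`, `hatD`, `hat_trunc`,
  ★★ `hat_ren` — the hat pair satisfies the matrix renewal equation; `hatPair : RenewalKernelPair (Fin (2T))`.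
* §C `hasSum_even_part`, `hasSum_odd_part`, `hatD_gf_eq` (`Σ_k D̂(k) t^{2k} = t^e D_T(t)`, `e ∈ {−1,0,1}`), ★★ `hatD_abel`
  (`(1 − s) Σ_k D̂(k)_{ab} s^k → 2L_{ab}`), ★★ `hatPair_critical` — the hat pair at `y_T` is `Critical` with `L̂ = 2ρ′u′ℓ′` (`T ≥ 2`).
* §D ★★★★ `exists_tendsto_LUM_parity` — THE POINTWISE LAW IN LENGTH: positive `u′, ℓ′, ρ′` (the SAME as in the x-residue, which is
  restated alongside) with `D(2k + χ_a − χ_b)_{ab} ⟶ 2ρ′ · u′_a ℓ′_b` for all levels `a, b` (`T ≥ 2`); ★★★ `exists_tendsto_LUM_even_diag`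
  — `D(2k)_{aa} → c_a > 0`.  Twice the Cesàro constant of «LENGTH-NEUMANN» §7, as it must be for period two.  ★★★ `exists_tendsto_LUM_exitLaw`
  — the EXIT LAW IN LENGTH: the end level of a long critical bridge of given length is asymptotically `∝ ℓ′` on its parity class.

Label: LANE THEOREM (own result of lane «pcv-sawmu», a-p2 g21, 2026-08-26).  NOT claimed: rates of convergence, the corresponding
statements for β-walks / chains / arches by length, uniformity in `T`, `T = 1` (explicit and excluded by `T ≥ 2`).
-/

noncomputable section

open Finset Filter Topology Matrix Literature.Probability.LatticeModels Literature.Probability.Percolation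
  Literature.Probability.Process Literature.Analysis.Matrix

namespace Literature.Probability.RandomPlanarGeometry.SAW

namespace HV

variable {T : ℕ}

/-! ## §A Even-length diagonal positivity: `D(2k)_{aa} > 0` (the aperiodicity input) -/


/-! ### §A.1 The renewal equation as a lower bound: `D(i + j) ≥ M(i) · D(j)`, hence `D(m) ≥ M(1)^m` -/

/-- `D(i + j)_{ab} ≥ (M(i) D(j))_{ab}` (`y ≥ 0`): one term of the renewal equation `D = M + Σ_{i+j} M(i) D(j)`.
[cite: DuminilCopinHammond2013, §2.2; Feller1968, XIII.3; lane plumbing] -/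
theorem LMM_mul_LUM_le_LUM {y : ℝ} (hy : 0 ≤ y) (i j : ℕ) (a b : Fin (2 * T)) :
    (LMM T i (i : ℤ) y * LUM T j (j : ℤ) y) a b ≤ LUM T (i + j) ((i + j : ℕ) : ℤ) y a b := by
  rw [LUM_ren hy (i + j), Matrix.add_apply, Matrix.sum_apply]
  have hM : 0 ≤ LMM T (i + j) ((i + j : ℕ) : ℤ) y a b := (LMM_LUM_nonneg hy _ a b).1
  have hterm : ∀ p ∈ antidiagonal (i + j), 0 ≤ (LMM T p.1 (p.1 : ℤ) y * LUM T p.2 (p.2 : ℤ) y) a b := fun p _ => by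
    rw [Matrix.mul_apply]
    exact sum_nonneg fun c _ => mul_nonneg (LMM_LUM_nonneg hy _ a c).1 (LMM_LUM_nonneg hy _ c b).2
  have hmem : (i, j) ∈ antidiagonal (i + j) := by rw [HasAntidiagonal.mem_antidiagonal]
  have := single_le_sum hterm hmem
  linarith

/-- `D(m)_{ab} ≥ (M(1)^m)_{ab}` for `m ≥ 1` (`y ≥ 0`): concatenations of `m` one-step irreducible bridges.
[cite: DuminilCopinHammond2013, §2.2 (concatenation of bridges is a bridge); lane plumbing] -/
theorem pow_LMM_one_le_LUM {y : ℝ} (hy : 0 ≤ y) (m : ℕ) (hm : 1 ≤ m) (a b : Fin (2 * T)) :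
    (LMM T 1 (1 : ℤ) y ^ m) a b ≤ LUM T m (m : ℤ) y a b := by
  induction m, hm using Nat.le_induction generalizing a b with
  | base => simpa using LMM_le_LUM_self hy 1 a b
  | succ m hm ih =>
    rw [pow_succ', Matrix.mul_apply]
    calc ∑ c, LMM T 1 (1 : ℤ) y a c * (LMM T 1 (1 : ℤ) y ^ m) c b ≤ ∑ c, LMM T 1 (1 : ℤ) y a c * LUM T m (m : ℤ) y c b :=
          sum_le_sum fun c _ => mul_le_mul_of_nonneg_left (ih c b) (LMM_LUM_nonneg hy _ a c).1
      _ = (LMM T 1 ((1 : ℕ) : ℤ) y * LUM T m (m : ℤ) y) a b := by rw [Matrix.mul_apply, Nat.cast_one]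
      _ ≤ LUM T (1 + m) ((1 + m : ℕ) : ℤ) y a b := LMM_mul_LUM_le_LUM hy 1 m a b
      _ = LUM T (m + 1) ((m + 1 : ℕ) : ℤ) y a b := by rw [Nat.add_comm]

/-- Diagonal entries of even powers of a non-negative matrix dominate powers of the diagonal of the square:
`(P^{2k})_{aa} ≥ ((P²)_{aa})^k` (plumbing). [cite: Seneta1973, §1.1; lane plumbing] -/
theorem pow_sq_apply_le_pow_two_mul {n : Type*} [Fintype n] [DecidableEq n] {P : Matrix n n ℝ} (hP : ∀ a b, 0 ≤ P a b) (a : n)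
    (k : ℕ) : ((P ^ 2) a a) ^ k ≤ (P ^ (2 * k)) a a := by
  have hpow : ∀ j (b c : n), 0 ≤ (P ^ j) b c := fun j b c => by
    induction j generalizing b c with
    | zero => rw [pow_zero, Matrix.one_apply]; split_ifs <;> norm_num
    | succ j ih => rw [pow_succ, Matrix.mul_apply]; exact sum_nonneg fun d _ => mul_nonneg (ih b d) (hP d c)
  induction k with
  | zero => simp
  | succ k ih =>
    rw [pow_succ, Nat.mul_succ, pow_add, Matrix.mul_apply]
    calc ((P ^ 2) a a) ^ k * (P ^ 2) a a ≤ (P ^ (2 * k)) a a * (P ^ 2) a a :=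
          mul_le_mul_of_nonneg_right ih (hpow 2 a a)
      _ ≤ ∑ c, (P ^ (2 * k)) a c * (P ^ 2) c a :=
          single_le_sum (f := fun c => (P ^ (2 * k)) a c * (P ^ 2) c a) (fun c _ => mul_nonneg (hpow _ a c) (hpow 2 c a))
            (mem_univ a)

/-! ### §A.2 One-step irreducible bridges between the paired levels `2j ↔ 2j+1`, and the even-length diagonal positivity -/

/-- `wD > 0` for `y > 0` (plumbing). [cite: DuminilCopinHammond2013, §2.2; lane plumbing] -/
theorem wD_pos (T : ℕ) {y : ℝ} (hy : 0 < y) (l : List HV) : 0 < wD T y l := by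
  unfold wD
  exact mul_pos (pow_pos hexCriticalFugacity_pos_lt_one.1 _) (pow_pos hy _)

/-- A listed irreducible bridge of length one makes `M(1)_{ab} > 0` (`y > 0`). [cite: DuminilCopinHammond2013, §2.2; lane plumbing] -/
theorem LMM_one_pos_of_mem {y : ℝ} (hy : 0 < y) {a b : Fin (2 * T)} {a' b' : ℤ} {u v : HV} (hl : [u, v] ∈ HBk T 1 1 a' b')
    (ha : a' = ((a : ℕ) : ℤ)) (hb : b' = ((b : ℕ) : ℤ)) : 0 < LMM T 1 (1 : ℤ) y a b := by
  subst ha; subst hb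
  have hmem : [u, v] ∈ LMset T 1 1 ((a : ℕ) : ℤ) ((b : ℕ) : ℤ) := by
    rw [LMset, mem_filter]
    exact ⟨hl, by simp [hlen]⟩
  rw [LMM, LMs]
  exact lt_of_lt_of_le (wD_pos T hy _) (single_le_sum (f := fun l => wD T y l) (fun l _ => wD_nonneg T hy.le l) hmem)

/-- ★ The one-step irreducible matrix links the paired levels both ways: `M(1)_{2j,2j+1} > 0` and `M(1)_{2j+1,2j} > 0` (`y > 0`;
right up-slant `(0,j,false) → (0,j,true)`, right down-slant `(0,j,true) → (1,j,false)`).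
[cite: DuminilCopinHammond2013, §2.2; DuminilCopinSmirnov2012, §3 (the edges of ℍ); lane plumbing] -/
theorem LMM_one_pair_pos {y : ℝ} (hy : 0 < y) (j : ℕ) (hj : j < T) :
    0 < LMM T 1 (1 : ℤ) y ⟨2 * j, by omega⟩ ⟨2 * j + 1, by omega⟩ ∧ 0 < LMM T 1 (1 : ℤ) y ⟨2 * j + 1, by omega⟩ ⟨2 * j, by omega⟩ := by
  have hA : hvGraph.Adj ((0 : ℤ), (j : ℤ), false) ((0 : ℤ), (j : ℤ), true) := by simp [hvGraph_adj, AdjRel]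
  have hB : hvGraph.Adj ((0 : ℤ), (j : ℤ), true) ((0 : ℤ) + 1, (j : ℤ), false) := by simp [hvGraph_adj, AdjRel]
  obtain ⟨l1, l2, x1, x2⟩ := lev_explicit 0 (j : ℤ)
  obtain ⟨l3, -, x3, -⟩ := lev_explicit 1 (j : ℤ)
  have h1 := pair_mem_HBk (T := T) (N := 1) le_rfl hA rfl (by rw [x1, x2]; omega) (by rw [l1]; omega) (by rw [l2]; omega)
  have h2 := pair_mem_HBk (T := T) (N := 1) le_rfl (by simpa using hB) rfl (by rw [x2, x3]; omega)
    (by rw [l2]; omega) (by rw [l3]; omega)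
  exact ⟨LMM_one_pos_of_mem hy h1 (by rw [l1]; norm_num) (by rw [l2]; norm_num),
    LMM_one_pos_of_mem hy h2 (by rw [l2]; norm_num) (by rw [l3]; norm_num)⟩

/-- ★★ **Even-length diagonal positivity** (the aperiodicity input of the period-two renewal theorem in length): for `y > 0`, every
level `a` and every `k ≥ 1`, `D(2k)_{aa} > 0` — there is a standard bridge `a → a` of EVERY even length (`k` up-down / down-up slant pairs),
so along its parity class the length kernel is aperiodic. [cite: DuminilCopinHammond2013, §2.2; Feller1968, XIII.3 (periodic renewal sequences); lane «pcv-sawmu» a-p2 g21 — own] -/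
theorem LUM_even_diag_pos {y : ℝ} (hy : 0 < y) (a : Fin (2 * T)) (k : ℕ) (hk : 1 ≤ k) :
    0 < LUM T (2 * k) ((2 * k : ℕ) : ℤ) y a a := by
  set P := LMM T 1 (1 : ℤ) y with hPdef
  have hP : ∀ b c, 0 ≤ P b c := fun b c => (LMM_LUM_nonneg hy.le _ b c).1
  -- the partner level
  have h2 : 0 < (P ^ 2) a a := by
    obtain ⟨j, hj⟩ : ∃ j : ℕ, (a : ℕ) = 2 * j ∨ (a : ℕ) = 2 * j + 1 := ⟨(a : ℕ) / 2, by omega⟩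
    have hjT : j < T := by have := a.isLt; omega
    obtain ⟨hup, hdn⟩ := LMM_one_pair_pos hy j hjT
    rw [pow_two, Matrix.mul_apply]
    rcases hj with hj | hj
    · have ha : a = ⟨2 * j, by omega⟩ := Fin.ext hj
      have hpos : 0 < P a ⟨2 * j + 1, by omega⟩ * P ⟨2 * j + 1, by omega⟩ a := by rw [ha]; exact mul_pos hup hdn
      exact lt_of_lt_of_le hpos
        (single_le_sum (f := fun c => P a c * P c a) (fun c _ => mul_nonneg (hP _ _) (hP _ _)) (mem_univ _))
    · have ha : a = ⟨2 * j + 1, by omega⟩ := Fin.ext hj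
      have hpos : 0 < P a ⟨2 * j, by omega⟩ * P ⟨2 * j, by omega⟩ a := by rw [ha]; exact mul_pos hdn hup
      exact lt_of_lt_of_le hpos
        (single_le_sum (f := fun c => P a c * P c a) (fun c _ => mul_nonneg (hP _ _) (hP _ _)) (mem_univ _))
  calc (0 : ℝ) < ((P ^ 2) a a) ^ k := pow_pos h2 k
    _ ≤ (P ^ (2 * k)) a a := pow_sq_apply_le_pow_two_mul hP a k
    _ ≤ LUM T (2 * k) ((2 * k : ℕ) : ℤ) y a a := pow_LMM_one_le_LUM hy.le (2 * k) (by omega) a a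



/-! ## §B Parity: a bridge from level `a` to level `b` with `σ` steps has `σ ≡ b − a (mod 2)` -/

/-- Along a lattice chain the level difference has the parity of the number of steps (each step moves the level by `±1`).
[cite: DuminilCopinSmirnov2012, §3 (the hexagonal lattice in the strip); lane plumbing] -/
theorem chain_parity_even : ∀ {l : List HV}, l.IsChain hvGraph.Adj → l ≠ [] → Even (ltLev l - hdLev l - hlen l)
  | [], _, h => absurd rfl h
  | [v], _, _ => by simp [ltLev, hdLev, hlen]
  | u :: v :: rest, hc, _ => by
    rw [List.isChain_cons_cons] at hc
    have ih := chain_parity_even hc.2 (List.cons_ne_nil v rest)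
    have hlt : ltLev (u :: v :: rest) = ltLev (v :: rest) := by simp [ltLev, List.getLast?_cons_cons]
    have hhd : hdLev (u :: v :: rest) = lev u := by simp [hdLev]
    have hhd' : hdLev (v :: rest) = lev v := by simp [hdLev]
    have hln : hlen (u :: v :: rest) = hlen (v :: rest) + 1 := by simp [hlen]
    rw [hlt, hhd, hln]
    rw [hhd'] at ih
    obtain ⟨k, hk⟩ := ih
    rcases lev_eq_of_adj hc.1 with h | h
    · exact ⟨k, by rw [h] at hk; omega⟩
    · exact ⟨k - 1, by rw [h] at hk; omega⟩

/-- ★ **Parity of the length slices**: `U_σ(a,b) = 0` and `M_σ(a,b) = 0` unless `σ + a + b` is even (i.e. `σ ≡ b − a`).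
[cite: DuminilCopinHammond2013, §2.2; DuminilCopinSmirnov2012, §3; lane plumbing] -/
theorem LUM_LMM_eq_zero_of_not_even {N : ℕ} {σ : ℤ} (y : ℝ) (a b : Fin (2 * T)) (h : ¬ Even (σ + (a : ℕ) + (b : ℕ))) :
    LUM T N σ y a b = 0 ∧ LMM T N σ y a b = 0 := by
  have key : ∀ {q : List HV}, q.IsChain hvGraph.Adj → 2 ≤ q.length → hdLev q = ((a : ℕ) : ℤ) → ltLev q = ((b : ℕ) : ℤ) →
      hlen q = σ → False := by
    intro q hc h2 ha hb hsz
    have hne : q ≠ [] := by rintro rfl; simp at h2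
    obtain ⟨k, hk⟩ := chain_parity_even hc hne
    rw [ha, hb, hsz] at hk
    exact h ⟨((b : ℕ) : ℤ) - k, by omega⟩
  constructor
  · rw [LUM, LUs]
    refine sum_eq_zero fun q hq => ?_
    obtain ⟨hc, -, -, -, -, -, h2, ha, hb, hsz⟩ := of_mem_LUset hq
    exact (key hc h2 ha hb hsz).elim
  · rw [LMM, LMs]
    refine sum_eq_zero fun q hq => ?_
    obtain ⟨hc, -, -, -, -, -, -, h2, ha, hb, hsz⟩ := of_mem_LMset hq
    exact (key hc h2 ha hb hsz).elim

/-! ## §B′ The parity-shifted ("hat") kernel pair: `M̂(k)_{ab} = M(2k + χ_a − χ_b)_{ab}`, `D̂(k)_{ab} = D(2k + χ_a − χ_b)_{ab}` -/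

/-- The parity `χ_a ∈ {0, 1}` of a level (plumbing). [cite: Feller1968, XIII.3 (periodic renewal sequences); lane plumbing] -/
def lchi (a : Fin (2 * T)) : ℤ := (((a : ℕ) % 2 : ℕ) : ℤ)

/-- The hat length `2k + χ_a − χ_b` (plumbing). [cite: Feller1968, XIII.3; lane plumbing] -/
def hatLen (k : ℕ) (a b : Fin (2 * T)) : ℤ := 2 * (k : ℤ) + lchi a - lchi b

/-- `χ_a ∈ {0,1}` and `χ_a ≡ a` (plumbing). [cite: Feller1968, XIII.3; lane plumbing] -/
theorem lchi_facts (a : Fin (2 * T)) : (lchi a = 0 ∨ lchi a = 1) ∧ Even (((a : ℕ) : ℤ) - lchi a) := by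
  unfold lchi
  refine ⟨by omega, ⟨((a : ℕ) / 2 : ℕ), by omega⟩⟩

/-- The hat one-piece kernel `M̂(k)_{ab} := M_{2k+χ_a−χ_b}(a,b)` at surface fugacity `y` (truncation `2k+1`, immaterial).
[cite: Feller1968, XIII.3 (reduction of a periodic renewal sequence to an aperiodic one); lane «pcv-sawmu» a-p2 g21] -/
def hatM (T : ℕ) (y : ℝ) (k : ℕ) : Matrix (Fin (2 * T)) (Fin (2 * T)) ℝ := fun a b => LMM T (2 * k + 1) (hatLen k a b) y a b

/-- The hat all-bridges kernel `D̂(k)_{ab} := U_{2k+χ_a−χ_b}(a,b)`. [cite: Feller1968, XIII.3; lane «pcv-sawmu» a-p2 g21] -/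
def hatD (T : ℕ) (y : ℝ) (k : ℕ) : Matrix (Fin (2 * T)) (Fin (2 * T)) ℝ := fun a b => LUM T (2 * k + 1) (hatLen k a b) y a b

/-- Truncation independence for the hat entries: any truncation `N ≥ 2k + χ_a − χ_b` gives the same value (plumbing).
[cite: DuminilCopinHammond2013, §2.2; lane plumbing] -/
theorem hat_trunc {y : ℝ} (k : ℕ) (a b : Fin (2 * T)) {N : ℕ} (hN : hatLen k a b ≤ (N : ℤ)) :
    LMM T N (hatLen k a b) y a b = hatM T y k a b ∧ LUM T N (hatLen k a b) y a b = hatD T y k a b := by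
  have h1 : hatLen k a b ≤ ((2 * k + 1 : ℕ) : ℤ) := by
    have := (lchi_facts a).1; have := (lchi_facts b).1; unfold hatLen; push_cast; omega
  obtain ⟨hU, hM⟩ := LUM_LMM_eq_of_le (T := T) hN h1 y
  exact ⟨by rw [hatM, hM], by rw [hatD, hU]⟩

/-- ★★ **The hat pair satisfies the matrix renewal equation** `D̂(k) = M̂(k) + Σ_{i+j=k} M̂(i) D̂(j)`: the exact equation in length
(`LUM_eq_split`) regrouped along the parity classes — in `Σ_{τ} M_τ(a,c) U_{σ−τ}(c,b)` only `τ ≡ χ_a − χ_c` contributes (parity), and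
`τ = 2i + χ_a − χ_c`, `σ − τ = 2j + χ_c − χ_b` with `i + j = k`.
[cite: Feller1968, XIII.3; DuminilCopinHammond2013, §2.2; lane «pcv-sawmu» a-p2 g21 — own] -/
theorem hat_ren {y : ℝ} (hy : 0 ≤ y) (k : ℕ) :
    hatD T y k = hatM T y k + ∑ p ∈ antidiagonal k, hatM T y p.1 * hatD T y p.2 := by
  ext a b
  have hχa := (lchi_facts a).1; have hχb := (lchi_facts b).1
  set σ : ℤ := hatLen k a b with hσdef
  have hσN : σ ≤ ((2 * k + 1 : ℕ) : ℤ) := by rw [hσdef]; unfold hatLen; push_cast; omega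
  rw [Matrix.add_apply, show hatD T y k a b = LUM T (2 * k + 1) σ y a b from rfl, LUM_eq_split hy hσN a b,
    show LMM T (2 * k + 1) σ y a b = hatM T y k a b from rfl]
  congr 1
  rw [Matrix.sum_apply, Matrix.sum_apply]
  simp only [Matrix.mul_apply]
  rw [sum_comm, sum_comm (s := antidiagonal k)]
  refine sum_congr rfl fun c _ => ?_
  have hχc := (lchi_facts c).1
  -- for the fixed middle level `c`: both sides are sums of `f τ := M_τ(a,c) U_{σ−τ}(c,b)` (truncation `2k+1`)
  set f : ℤ → ℝ := fun τ => LMM T (2 * k + 1) τ y a c * LUM T (2 * k + 1) (σ - τ) y c b with hfdef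
  set δ₁ : ℤ := lchi a - lchi c with hδ₁
  -- right side, rewritten with truncation `2k+1` and as an image sum
  have hR : ∑ p ∈ antidiagonal k, hatM T y p.1 a c * hatD T y p.2 c b = ∑ i ∈ range (k + 1), f (2 * (i : ℤ) + δ₁) := by
    rw [Nat.sum_antidiagonal_eq_sum_range_succ_mk]
    refine sum_congr rfl fun i hi => ?_
    rw [mem_range] at hi
    have hi1 : hatLen i a c ≤ ((2 * k + 1 : ℕ) : ℤ) := by unfold hatLen; push_cast; omega
    have hi2 : hatLen (k - i) c b ≤ ((2 * k + 1 : ℕ) : ℤ) := by unfold hatLen; push_cast; omega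
    rw [← (hat_trunc i a c hi1).1, ← (hat_trunc (k - i) c b hi2).2, hfdef]
    simp only
    have e1 : hatLen i a c = 2 * (i : ℤ) + δ₁ := by rw [hδ₁]; unfold hatLen; ring
    have e2 : hatLen (k - i) c b = σ - (2 * (i : ℤ) + δ₁) := by
      rw [hσdef, hδ₁]; unfold hatLen; push_cast [Nat.cast_sub (show i ≤ k by omega)]; ring
    rw [e1, e2]
  rw [hR]
  -- the image set `S = {2i + δ₁ : i ≤ k}`; both sums equal the sum over `Ico 1 σ ∩ S` (the other terms vanish)
  have hinj : Set.InjOn (fun i : ℕ => 2 * (i : ℤ) + δ₁) (range (k + 1) : Finset ℕ) := fun i _ j _ h => by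
    simpa using h
  rw [← sum_image hinj]
  set S : Finset ℤ := (range (k + 1)).image (fun i : ℕ => 2 * (i : ℤ) + δ₁) with hSdef
  change ∑ τ ∈ Finset.Ico (1 : ℤ) σ, f τ = ∑ τ ∈ S, f τ
  have hvan1 : ∀ τ ∈ S, τ ∉ Finset.Ico (1 : ℤ) σ → f τ = 0 := by
    intro τ hτ hτI
    rw [hSdef, mem_image] at hτ
    obtain ⟨i, hi, rfl⟩ := hτ
    rw [mem_range] at hi
    rw [Finset.mem_Ico, not_and_or, not_le, not_lt] at hτI
    rw [hfdef]; simp only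
    rcases hτI with h0 | h0
    · rw [LMM_eq_zero_of_le (by omega), zero_mul]
    · rw [LUM_eq_zero_of_le (by omega), mul_zero]
  have hvan2 : ∀ τ ∈ Finset.Ico (1 : ℤ) σ, τ ∉ S → f τ = 0 := by
    intro τ hτI hτ
    rw [Finset.mem_Ico] at hτI
    rw [hfdef]; simp only
    -- `τ ≢ δ₁ (mod 2)`, else `τ = 2i + δ₁` with `i ≤ k`
    have hpar : ¬ Even (τ + (a : ℕ) + (c : ℕ)) := by
      rintro ⟨m, hm⟩
      apply hτ
      obtain ⟨ja, hja⟩ := (lchi_facts a).2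
      obtain ⟨jc, hjc⟩ := (lchi_facts c).2
      have hσ' : σ = 2 * (k : ℤ) + lchi a - lchi b := by rw [hσdef]; unfold hatLen; ring
      rw [hSdef, mem_image]
      exact ⟨((τ - δ₁) / 2).toNat, mem_range.2 (by omega), (by omega : 2 * ((((τ - δ₁) / 2).toNat : ℕ) : ℤ) + δ₁ = τ)⟩
    rw [(LUM_LMM_eq_zero_of_not_even y a c hpar).2, zero_mul]
  have e1 : ∑ τ ∈ Finset.Ico (1 : ℤ) σ ∩ S, f τ = ∑ τ ∈ Finset.Ico (1 : ℤ) σ, f τ :=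
    sum_subset inter_subset_left fun τ hτI hτn => hvan2 τ hτI fun hτS => hτn (mem_inter.2 ⟨hτI, hτS⟩)
  have e2 : ∑ τ ∈ Finset.Ico (1 : ℤ) σ ∩ S, f τ = ∑ τ ∈ S, f τ :=
    sum_subset inter_subset_right fun τ hτS hτn => hvan1 τ hτS fun hτI => hτn (mem_inter.2 ⟨hτI, hτS⟩)
  rw [← e1, e2]

/-- ★★ **The hat renewal pair** of the strip bridges in the length variable at surface fugacity `y ≥ 0` (a
`Process.RenewalKernelPair` on the `2T` levels). [cite: Feller1968, XIII.3; DuminilCopinHammond2013, §2.2; lane «pcv-sawmu» a-p2 g21] -/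
def hatPair (T : ℕ) {y : ℝ} (hy : 0 ≤ y) : RenewalKernelPair (Fin (2 * T)) where
  M := hatM T y
  D := hatD T y
  M_nonneg := fun _ a b => (LMM_LUM_nonneg hy _ a b).1
  D_nonneg := fun _ a b => (LMM_LUM_nonneg hy _ a b).2
  ren := hat_ren hy


/-! ## §C The hat pair at `y = y_T` is critical in the sense of `RenewalKernelPair.Critical` -/

/-- Even part of a series whose odd terms vanish (plumbing). [cite: Feller1968, XIII.3; lane plumbing] -/
theorem hasSum_even_part {f : ℕ → ℝ} {S : ℝ} (hf : HasSum f S) (hodd : ∀ k, f (2 * k + 1) = 0) :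
    HasSum (fun k => f (2 * k)) S := by
  have he : Summable fun k => f (2 * k) := hf.summable.comp_injective (i := fun k : ℕ => 2 * k) fun x y h => by simpa using h
  have ho : Summable fun k => f (2 * k + 1) := hf.summable.comp_injective (i := fun k : ℕ => 2 * k + 1) fun x y h => by
    simpa using h
  have h := HasSum.even_add_odd he.hasSum ho.hasSum
  have hB : ∑' k, f (2 * k + 1) = 0 := by rw [tsum_congr hodd, tsum_zero]
  rw [hB, add_zero] at h
  rw [hf.unique h]; exact he.hasSum

/-- Odd part of a series whose even terms vanish (plumbing). [cite: Feller1968, XIII.3; lane plumbing] -/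
theorem hasSum_odd_part {f : ℕ → ℝ} {S : ℝ} (hf : HasSum f S) (heven : ∀ k, f (2 * k) = 0) :
    HasSum (fun k => f (2 * k + 1)) S := by
  have he : Summable fun k => f (2 * k) := hf.summable.comp_injective (i := fun k : ℕ => 2 * k) fun x y h => by simpa using h
  have ho : Summable fun k => f (2 * k + 1) := hf.summable.comp_injective (i := fun k : ℕ => 2 * k + 1) fun x y h => by
    simpa using h
  have h := HasSum.even_add_odd he.hasSum ho.hasSum
  have hA : ∑' k, f (2 * k) = 0 := by rw [tsum_congr heven, tsum_zero]
  rw [hA, zero_add] at h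
  rw [hf.unique h]; exact ho.hasSum

/-- The hat generating function is the parity-class generating function: for `0 < t < 1` there is `e ∈ {−1, 0, 1}` (`e = χ_b − χ_a`) with
`Σ_k D̂(k)_{ab} t^{2k} = t^e · D_T(t)_{ab}` — all lengths `a → b` have the parity of `χ_a − χ_b` (plumbing for the Abelian hypothesis).
[cite: Feller1968, XIII.3 (periodic renewal sequences); lane «pcv-sawmu» a-p2 g21] -/
theorem hatD_gf_eq (hT : 1 ≤ T) (a b : Fin (2 * T)) : ∃ e : ℤ, ∀ t ∈ Set.Ioo (0 : ℝ) 1,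
    HasSum (fun k : ℕ => hatD T (stripYT T) k a b * (t ^ 2) ^ k) (t ^ e * stripLenD T t a b) := by
  obtain ⟨hχa, hea⟩ := lchi_facts a
  obtain ⟨hχb, heb⟩ := lchi_facts b
  -- the canonical sequence and its parity vanishing
  have hhat : ∀ k n : ℕ, (n : ℤ) = hatLen k a b → hatD T (stripYT T) k a b = LUM T n (n : ℤ) (stripYT T) a b := by
    intro k n hn
    rw [hn, (hat_trunc k a b (le_of_eq hn.symm)).2]
  have hDpar : ∀ n : ℕ, ¬ Even ((n : ℤ) + lchi a + lchi b) → LUM T n (n : ℤ) (stripYT T) a b = 0 := by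
    intro n hn
    refine (LUM_LMM_eq_zero_of_not_even (stripYT T) a b fun h => hn ?_).1
    obtain ⟨ja, hja⟩ := hea; obtain ⟨jb, hjb⟩ := heb; obtain ⟨m, hm⟩ := h
    exact ⟨m - ja - jb, by omega⟩
  have hD : ∀ t ∈ Set.Ioo (0 : ℝ) 1, HasSum (fun n : ℕ => LUM T n (n : ℤ) (stripYT T) a b * t ^ n) (stripLenD T t a b) :=
    fun t ht => (lenSlices_basic hT a b ht.1.le ht.2).2.1.hasSum
  rcases Int.emod_two_eq_zero_or_one (lchi a + lchi b) with hpar | hpar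
  · -- same parity: even lengths, `D̂(k) = D(2k)`, `e = 0`
    have hab : lchi a = lchi b := by rcases hχa with h | h <;> rcases hχb with h' | h' <;> rw [h, h'] at hpar ⊢ <;> omega
    refine ⟨0, fun t ht => ?_⟩
    rw [zpow_zero, one_mul]
    have h := hasSum_even_part (hD t ht) fun k => by
      rw [hDpar (2 * k + 1) (fun ⟨m, hm⟩ => by push_cast at hm; omega), zero_mul]
    refine h.congr_fun fun k => ?_
    rw [hhat k (2 * k) (by unfold hatLen; rw [hab]; push_cast; ring), ← pow_mul]
  · have hab : (lchi a = 0 ∧ lchi b = 1) ∨ (lchi a = 1 ∧ lchi b = 0) := by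
      rcases hχa with h | h <;> rcases hχb with h' | h' <;> rw [h, h'] at hpar ⊢ <;> omega
    rcases hab with ⟨ha0, hb1⟩ | ⟨ha1, hb0⟩
    · -- lengths `2k − 1`: `D̂(0) = 0`, `D̂(k+1) t^{2k+2} = t · D(2k+1) t^{2k+1}`, `e = 1`
      refine ⟨1, fun t ht => ?_⟩
      rw [zpow_one]
      have h := hasSum_odd_part (hD t ht) fun k => by
        rw [hDpar (2 * k) (fun ⟨m, hm⟩ => by rw [ha0, hb1] at hm; push_cast at hm; omega), zero_mul]
      have h1 : HasSum (fun k : ℕ => hatD T (stripYT T) (k + 1) a b * (t ^ 2) ^ (k + 1)) (t * stripLenD T t a b) := by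
        refine (h.mul_left t).congr_fun fun k => ?_
        rw [hhat (k + 1) (2 * k + 1) (by unfold hatLen; rw [ha0, hb1]; push_cast; ring), ← pow_mul]
        ring
      have h0 : hatD T (stripYT T) 0 a b = 0 := by
        rw [hatD]
        exact LUM_eq_zero_of_le (by unfold hatLen; rw [ha0, hb1]; norm_num) _ a b
      exact (hasSum_nat_add_iff' (f := fun k : ℕ => hatD T (stripYT T) k a b * (t ^ 2) ^ k) 1).1
        (by rw [sum_range_one, h0, zero_mul, sub_zero]; exact h1)
    · -- lengths `2k + 1`: `D̂(k) t^{2k} = t⁻¹ · D(2k+1) t^{2k+1}`, `e = −1`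
      refine ⟨-1, fun t ht => ?_⟩
      rw [_root_.zpow_neg, zpow_one]
      have h := hasSum_odd_part (hD t ht) fun k => by
        rw [hDpar (2 * k) (fun ⟨m, hm⟩ => by rw [ha1, hb0] at hm; push_cast at hm; omega), zero_mul]
      refine (h.mul_left t⁻¹).congr_fun fun k => ?_
      rw [hhat k (2 * k + 1) (by unfold hatLen; rw [ha1, hb0]; push_cast; ring), ← pow_mul, pow_succ]
      field_simp [ht.1.ne']

/-- ★★ **The Abelian hypothesis for the hat pair**: `(1 − s) Σ_k D̂(k)_{ab} s^k → 2 L_{ab}` as `s ↑ 1`, where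
`(1 − t) D_T(t)_{ab} → L_{ab}` (substitute `s = t²`: `(1 − t²) t^e D_T(t) = (1 + t) t^e · (1 − t) D_T(t)`).
[cite: Feller1968, XIII.3, XIII.5; Seneta1973, Chapter 6; lane «pcv-sawmu» a-p2 g21] -/
theorem hatD_abel (hT : 1 ≤ T) (a b : Fin (2 * T)) {L : ℝ}
    (hres : Tendsto (fun t : ℝ => (1 - t) * stripLenD T t a b) (𝓝[<] 1) (𝓝 L)) :
    Tendsto (fun s : ℝ => (1 - s) * ∑' k : ℕ, hatD T (stripYT T) k a b * s ^ k) (𝓝[<] 1) (𝓝 (2 * L)) := by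
  obtain ⟨e, he⟩ := hatD_gf_eq hT a b
  -- in the variable `t = √s`
  have hsqrt : Tendsto Real.sqrt (𝓝[<] (1 : ℝ)) (𝓝[<] 1) := by
    refine tendsto_nhdsWithin_of_tendsto_nhds_of_eventually_within _ ?_ ?_
    · have := Real.continuous_sqrt.tendsto (1 : ℝ)
      rw [Real.sqrt_one] at this
      exact this.mono_left nhdsWithin_le_nhds
    · filter_upwards [Ioo_mem_nhdsLT zero_lt_one] with s hs
      rw [Set.mem_Iio, Real.sqrt_lt' zero_lt_one, one_pow]
      exact hs.2
  have hG : Tendsto (fun t : ℝ => (1 + t) * t ^ e * ((1 - t) * stripLenD T t a b)) (𝓝[<] 1) (𝓝 ((1 + 1) * (1 : ℝ) ^ e * L)) := by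
    refine Tendsto.mul (Tendsto.mul ?_ ?_) hres
    · exact ((continuous_const.add continuous_id).tendsto 1).mono_left nhdsWithin_le_nhds
    · exact ((continuousAt_zpow₀ 1 e (Or.inl one_ne_zero)).tendsto).mono_left nhdsWithin_le_nhds
  rw [_root_.one_zpow, mul_one, show (1 : ℝ) + 1 = 2 by norm_num] at hG
  refine ((hG.comp hsqrt).congr' ?_)
  filter_upwards [Ioo_mem_nhdsLT zero_lt_one] with s hs
  have ht : Real.sqrt s ∈ Set.Ioo (0 : ℝ) 1 :=
    ⟨Real.sqrt_pos.2 hs.1, by rw [Real.sqrt_lt' zero_lt_one, one_pow]; exact hs.2⟩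
  have hs2 : Real.sqrt s ^ 2 = s := Real.sq_sqrt hs.1.le
  simp only [Function.comp]
  have hts : ∑' k : ℕ, hatD T (stripYT T) k a b * s ^ k = Real.sqrt s ^ e * stripLenD T (Real.sqrt s) a b := by
    have := (he _ ht).tsum_eq; simp only [hs2] at this; exact this
  rw [hts]
  have : (1 : ℝ) - s = (1 + Real.sqrt s) * (1 - Real.sqrt s) := by linear_combination hs2
  rw [this]; ring

/-- ★★ **Criticality of the hat pair at `y_T`** (`T ≥ 2`): the five hypotheses of the matrix renewal theorem
(`RenewalKernelPair.Critical`) — summability of `Σ_k D̂(k) s^k` (pointwise bound at `y_T`), the Abelian limit `2L` (x-residue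
«LENGTH-NEUMANN»), `2L > 0`, finite first moment of `M̂` (finite mean length «LENGTH-NEUMANN» §8), aperiodicity (`D̂(k)_{oo} = D(2k)_{oo} > 0`,
«LENGTH-APERIODIC»). [cite: Feller1968, XIII.3, XIII.11; Seneta1973, Chapter 6; lane «pcv-sawmu» a-p2 g21 — own] -/
theorem hatPair_critical (hT : 2 ≤ T) {u ℓ : Fin (2 * T) → ℝ} {ρ : ℝ} (hu : ∀ a, 0 < u a) (hℓ : ∀ b, 0 < ℓ b) (hρ : 0 < ρ)
    (hres : ∀ a b, Tendsto (fun s : ℝ => (1 - s) * stripLenD T s a b) (𝓝[<] 1) (𝓝 (ρ * (u a * ℓ b)))) :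
    (hatPair T (stripYT_pos (show 1 ≤ T by omega)).le).Critical fun a b => 2 * (ρ * (u a * ℓ b)) := by
  have hT1 : 1 ≤ T := by omega
  have hy0 := stripYT_pos hT1
  refine ⟨fun a b s hs0 hs1 => ?_, fun a b => hatD_abel hT1 a b (hres a b), fun a b => by
    have := hu a; have := hℓ b; positivity, fun a b => ?_, ?_⟩
  · -- summability: `D̂(k)_{ab} ≤ K`
    obtain ⟨K, hK⟩ := exists_LUs_stripYT_le hT1
    have hK0 : 0 ≤ K := (LUs_LMs_nonneg hy0.le _ _).1.trans (hK 0 0 a b)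
    refine (summable_geometric_of_lt_one hs0 hs1).mul_left K |>.of_nonneg_of_le
      (fun k => mul_nonneg (LMM_LUM_nonneg hy0.le _ a b).2 (pow_nonneg hs0 _)) fun k => ?_
    exact mul_le_mul_of_nonneg_right (hK _ _ a b) (pow_nonneg hs0 _)
  · -- finite first moment of `M̂`
    obtain ⟨hχa, -⟩ := lchi_facts a
    obtain ⟨hχb, -⟩ := lchi_facts b
    set δ : ℤ := lchi a - lchi b with hδ
    set g : ℕ → ℝ := fun n => (n : ℝ) * LMM T n (n : ℤ) (stripYT T) a b with hgdef
    have hg : Summable g := summable_length_mul_LMM hT a b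
    have hg0 : ∀ n, 0 ≤ g n := fun n => mul_nonneg (Nat.cast_nonneg _) (LMM_LUM_nonneg hy0.le _ a b).1
    set φ : ℕ → ℕ := fun k => (2 * (k : ℤ) + δ).toNat with hφdef
    have hφ : Function.Injective φ := by
      intro k k' h
      rw [hφdef] at h; simp only at h
      rcases hχa with h1 | h1 <;> rcases hχb with h2 | h2 <;> (rw [hδ, h1, h2] at h; omega)
    have hgφ : Summable (g ∘ φ) := hg.comp_injective hφ
    refine hgφ.of_nonneg_of_le (fun k => mul_nonneg (Nat.cast_nonneg _) (LMM_LUM_nonneg hy0.le _ a b).1) fun k => ?_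
    show (k : ℝ) * hatM T (stripYT T) k a b ≤ g (φ k)
    rcases Nat.eq_zero_or_pos k with hk | hk
    · subst hk
      rcases le_or_gt (1 : ℤ) δ with hd | hd
      · -- `δ = 1`: `M̂(0) = M(1)`, coefficient `0`
        rw [Nat.cast_zero, zero_mul]; exact hg0 _
      · rw [Nat.cast_zero, zero_mul]; exact hg0 _
    · have hlen : ((φ k : ℕ) : ℤ) = hatLen k a b := by
        rw [hφdef]; simp only; unfold hatLen
        rcases hχa with h1 | h1 <;> rcases hχb with h2 | h2 <;> (rw [hδ, h1, h2]; push_cast; omega)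
      rw [← (hat_trunc k a b (le_of_eq hlen.symm)).1, ← hlen, hgdef]
      refine mul_le_mul_of_nonneg_right ?_ (LMM_LUM_nonneg hy0.le _ a b).1
      have : (k : ℤ) ≤ ((φ k : ℕ) : ℤ) := by
        rw [hlen]; unfold hatLen
        rcases hχa with h1 | h1 <;> rcases hχb with h2 | h2 <;> (rw [h1, h2]; omega)
      exact_mod_cast this
  · -- aperiodicity at the level `0`: `D̂(1)_{00} = D(2)_{00} > 0`
    refine ⟨⟨0, by omega⟩, Nat.dvd_one.1 (Nat.setGcd_dvd_of_mem ?_)⟩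
    show 0 < hatD T (stripYT T) 1 ⟨0, by omega⟩ ⟨0, by omega⟩
    have hlen : hatLen 1 (⟨0, by omega⟩ : Fin (2 * T)) ⟨0, by omega⟩ = ((2 * 1 : ℕ) : ℤ) := by
      unfold hatLen lchi; norm_num
    rw [← (hat_trunc 1 _ _ (le_of_eq hlen)).2, hlen]
    exact LUM_even_diag_pos hy0 _ 1 le_rfl

/-! ## §D ★★★★ THE POINTWISE LAW OF THE CRITICAL STRIP BRIDGES IN LENGTH (along the parity classes) -/

/-- ★★★★ **THE POINTWISE LAW IN LENGTH** (`T ≥ 2`): there are positive `u′`, `ℓ′` on the `2T` levels and `ρ′ > 0` — the SAME data as the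
residue of the bridge kernel in the length fugacity — such that for all levels `a, b`,
`D(2k + χ_a − χ_b)_{ab} ⟶ 2ρ′ · u′_a ℓ′_b` as `k → ∞`,
where `D(n)_{ab} = LUM T n n y_T a b` is the `x_c^n y_T^{#top}`-weight of the standard horizontal bridges `a → b` of `S_T` with exactly
`n` steps and `χ` is the level parity (the only lengths that occur).  Twice the Cesàro constant of «LENGTH-NEUMANN» §7, as it must be
for a period-two sequence.  Route: the parity-shifted hat pair is a `RenewalKernelPair` (§2) which is `Critical` (§3); the tree's matrix
renewal theorem `RenewalKernelPair.tendsto_coeff` (Erdős–Feller–Pollard through the taboo decomposition) gives the limit.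
[cite: Feller1968, XIII.3, XIII.11 (renewal theorem, periodic case); Seneta1973, Chapter 6; DuminilCopinHammond2013, §2.2; Kesten1963SAW, §4; lane «pcv-sawmu» a-p2 g21 — own result] -/
theorem exists_tendsto_LUM_parity (hT : 2 ≤ T) :
    ∃ (u ℓ : Fin (2 * T) → ℝ) (ρ : ℝ), (∀ a, 0 < u a) ∧ (∀ b, 0 < ℓ b) ∧ 0 < ρ ∧
      (∀ a b, Tendsto (fun s : ℝ => (1 - s) * stripLenD T s a b) (𝓝[<] 1) (𝓝 (ρ * (u a * ℓ b)))) ∧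
      ∀ a b, Tendsto (fun k : ℕ => LUM T (2 * k + 1) (2 * (k : ℤ) + lchi a - lchi b) (stripYT T) a b) atTop
        (𝓝 (2 * (ρ * (u a * ℓ b)))) := by
  obtain ⟨u, ℓ, ρ, hu, hℓ, hρ, hres⟩ := exists_tendsto_stripLenD_residue hT
  refine ⟨u, ℓ, ρ, hu, hℓ, hρ, hres, fun a b => ?_⟩
  have hK := hatPair_critical hT hu hℓ hρ hres
  exact RenewalKernelPair.tendsto_coeff _ hK a b

/-- ★★★ **Even lengths on the diagonal**: `D(2k)_{aa} → 2ρ′ u′_a ℓ′_a > 0` (`T ≥ 2`) — the `x_c^{2k} y_T^{#top}`-weight of the bridges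
returning to their starting level after exactly `2k` steps converges to a positive constant.
[cite: Feller1968, XIII.3; DuminilCopinHammond2013, §2.2; lane «pcv-sawmu» a-p2 g21 — own result] -/
theorem exists_tendsto_LUM_even_diag (hT : 2 ≤ T) :
    ∃ c : Fin (2 * T) → ℝ, (∀ a, 0 < c a) ∧
      ∀ a, Tendsto (fun k : ℕ => LUM T (2 * k) ((2 * k : ℕ) : ℤ) (stripYT T) a a) atTop (𝓝 (c a)) := by
  obtain ⟨u, ℓ, ρ, hu, hℓ, hρ, -, hlim⟩ := exists_tendsto_LUM_parity hT
  refine ⟨fun a => 2 * (ρ * (u a * ℓ a)), fun a => by have := hu a; have := hℓ a; positivity, fun a => ?_⟩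
  refine (hlim a a).congr fun k => ?_
  have hlen : hatLen k a a = ((2 * k : ℕ) : ℤ) := by unfold hatLen; push_cast; ring
  have h := (hat_trunc (y := stripYT T) k a a (le_of_eq hlen)).2
  change hatD T (stripYT T) k a a = _
  rw [← h, hlen]


/-- ★★★ **THE EXIT LAW IN LENGTH**: among the critical bridges of `S_T` from level `a` with exactly `n = 2k + χ_a − χ_b` steps
(`x_c^n y_T^{#top}`-weighted), the fraction ending at level `b` converges to `ℓ′_b / Σ_{b′ ≡ b} ℓ′_{b′}` — the end level of a long
critical bridge of GIVEN LENGTH is asymptotically distributed ∝ `ℓ′` on its parity class, independently of the starting level (`T ≥ 2`).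
[cite: Feller1968, XIII.3; DuminilCopinHammond2013, §2.2; lane «pcv-sawmu» a-p2 g21 — own result] -/
theorem exists_tendsto_LUM_exitLaw (hT : 2 ≤ T) :
    ∃ ℓ : Fin (2 * T) → ℝ, (∀ b, 0 < ℓ b) ∧ ∀ a b,
      Tendsto (fun k : ℕ => LUM T (2 * k + 1) (2 * (k : ℤ) + lchi a - lchi b) (stripYT T) a b /
          ∑ b', LUM T (2 * k + 1) (2 * (k : ℤ) + lchi a - lchi b) (stripYT T) a b') atTop
        (𝓝 (ℓ b / ∑ b' ∈ univ.filter (fun b' => lchi b' = lchi b), ℓ b')) := by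
  classical
  obtain ⟨u, ℓ, ρ, hu, hℓ, hρ, -, hlim⟩ := exists_tendsto_LUM_parity hT
  refine ⟨ℓ, hℓ, fun a b => ?_⟩
  -- the denominator: endpoints of the other parity carry no weight
  have hden : Tendsto (fun k : ℕ => ∑ b', LUM T (2 * k + 1) (2 * (k : ℤ) + lchi a - lchi b) (stripYT T) a b') atTop
      (𝓝 (∑ b', if lchi b' = lchi b then 2 * (ρ * (u a * ℓ b')) else 0)) := by
    refine tendsto_finsetSum _ fun b' _ => ?_
    split_ifs with hb'
    · rw [← hb']; exact hlim a b'
    · refine tendsto_const_nhds.congr fun k => ?_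
      refine ((LUM_LMM_eq_zero_of_not_even (stripYT T) a b' fun ⟨m, hm⟩ => hb' ?_).1).symm
      obtain ⟨ja, hja⟩ := (lchi_facts a).2
      obtain ⟨jb, hjb⟩ := (lchi_facts b').2
      have h1 := (lchi_facts b').1; have h2 := (lchi_facts b).1
      omega
  have hS : ∑ b', (if lchi b' = lchi b then 2 * (ρ * (u a * ℓ b')) else 0) =
      2 * (ρ * u a) * ∑ b' ∈ univ.filter (fun b' => lchi b' = lchi b), ℓ b' := by
    rw [← sum_filter, mul_sum]
    exact sum_congr rfl fun b' _ => by ring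
  have hSpos : 0 < ∑ b' ∈ univ.filter (fun b' => lchi b' = lchi b), ℓ b' :=
    lt_of_lt_of_le (hℓ b) (single_le_sum (f := ℓ) (fun b' _ => (hℓ b').le) (mem_filter.2 ⟨mem_univ b, rfl⟩))
  rw [hS] at hden
  have hne : 2 * (ρ * u a) * ∑ b' ∈ univ.filter (fun b' => lchi b' = lchi b), ℓ b' ≠ 0 := by
    have := hu a; positivity
  have h := (hlim a b).div hden hne
  refine h.congr' (Eventually.of_forall fun k => rfl) |>.trans ?_
  rw [show 2 * (ρ * (u a * ℓ b)) / (2 * (ρ * u a) * ∑ b' ∈ univ.filter (fun b' => lchi b' = lchi b), ℓ b') =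
      ℓ b / ∑ b' ∈ univ.filter (fun b' => lchi b' = lchi b), ℓ b' by
    have := hu a; field_simp]

end HV

end Literature.Probability.RandomPlanarGeometry.SAW
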